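import Summits.FinalStateConjecture.FinalStateConjecture.Theorems.EIHFluxBalanceInertialRecessionStubEndgameOracleTight
import Summits.FinalStateConjecture.FinalStateConjecture.Theorems.EIHFluxBalanceInertialRecessionVirialCold

/-!
# Route EIHFluxBalance — crux `InertialRecession`, abstract endgame for general `N`:
# frozen charges of an isolated cluster (toward LEMMA SPLIT)

Helper file for the crux `stmt-FinalStateConjecture-10166` (virial route, `work/split/PLAN.md`). Mathlib-only. A member set
`A ∋ a` whose members stay within `ηs/8` of `ξₐ` and whose non-members stay `≥ ηs` away on `[t₁, t₂]` carries the window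
`(ξₐ, ηs/4)`; the window law and the identification (instances at threshold `ρ ≤ ηs/8`, clearance `1/2`) freeze its energy
`E_A = Σ Mⱼγⱼ`, its momentum `P_A = Σ Mⱼγⱼvⱼ` and hence its internal energy `K_A = E_A − √(M_A² + ‖P_A‖²)` up to
`Bd = |C|·2(η/4)^{-3/2}t₁^{-1/2} + ζ(t₁) + ζ(t₂)` (`cluster_charge_frozen`: `|ΔE_A| ≤ Bd`, `‖ΔP_A‖ ≤ 3Bd`, `|ΔK_A| ≤ 4Bd`).
-/

noncomputable section

open Finset Filter Topology MeasureTheory intervalIntegral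

namespace Summit.FinalStateConjecture.FinalStateConjecture.Theorems.SublinearIsFree.Virial

open Literature.Geometry.Lorentzian

variable {N : ℕ}

/-- **Frozen charges of an isolated cluster** (see the module docstring). [folklore] -/
theorem cluster_charge_frozen (M : Fin N → ℝ) (ξ v : Fin N → ℝ → E3) (κ : ℝ) (P : ℝ → E3 → ℝ → Fin 4 → ℝ)
    (ρ : ℝ → ℝ) (C T T' T₀ : ℝ) (ζ : ℝ → ℝ)
    (hWL : ∀ (t₁ t₂ : ℝ) (c : ℝ → E3) (R : ℝ → ℝ), T ≤ t₁ → t₁ ≤ t₂ →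
      (∀ s ∈ Set.Icc t₁ t₂, ∀ s' ∈ Set.Icc t₁ t₂, ‖c s - c s'‖ ≤ 2 * |s - s'| ∧ |R s - R s'| ≤ 2 * |s - s'|) →
      (∀ s ∈ Set.Icc t₁ t₂, ρ s ≤ (1 / 2) * R s ∧ ‖c s‖ + R s ≤ (κ + κ ^ 2) / 2 * s ∧
        ∀ j, ‖ξ j s - c s‖ ≤ (1 - 1 / 2) * R s ∨ (1 + 1 / 2) * R s ≤ ‖ξ j s - c s‖) →
      ∀ μ : Fin 4, |P t₂ (c t₂) (R t₂) μ - P t₁ (c t₁) (R t₁) μ| ≤ C * ∫ s in t₁..t₂, (R s ^ (3 / 2 : ℝ))⁻¹)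
    (hID : ∀ (t : ℝ) (c : E3) (R : ℝ) (A : Finset (Fin N)), T' ≤ t → ρ t ≤ (1 / 2) * R →
      ‖c‖ + R ≤ (κ + κ ^ 2) / 2 * t →
      (∀ j, ‖ξ j t - c‖ ≤ (1 - 1 / 2) * R ∨ (1 + 1 / 2) * R ≤ ‖ξ j t - c‖) →
      (∀ j, j ∈ A ↔ ‖ξ j t - c‖ ≤ (1 - 1 / 2) * R) →
      |P t c R 0 - ∑ j ∈ A, M j * (√(1 - ‖v j t‖ ^ 2))⁻¹| ≤ ζ t ∧
      ∀ k : Fin 3, |P t c R k.succ - ∑ j ∈ A, M j * (√(1 - ‖v j t‖ ^ 2))⁻¹ * v j t k| ≤ ζ t)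
    (hdiff : ∀ i, Differentiable ℝ (ξ i)) (hspeed : ∀ i s, T₀ ≤ s → ‖deriv (ξ i) s‖ ≤ 2)
    {A : Finset (Fin N)} {a : Fin N}
    {t₁ t₂ η : ℝ} (hη : 0 < η) (hη8 : η ≤ 8) (hT : T ≤ t₁) (hT' : T' ≤ t₁) (hT₀ : T₀ ≤ t₁) (ht₁ : 0 < t₁)
    (h12 : t₁ ≤ t₂) (hρ : ∀ s ∈ Set.Icc t₁ t₂, ρ s ≤ η * s / 8)
    (hcap : ∀ s ∈ Set.Icc t₁ t₂, ‖ξ a s‖ + η / 4 * s ≤ (κ + κ ^ 2) / 2 * s)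
    (hmem : ∀ s ∈ Set.Icc t₁ t₂, ∀ i ∈ A, ‖ξ i s - ξ a s‖ ≤ η * s / 8)
    (hnon : ∀ s ∈ Set.Icc t₁ t₂, ∀ j ∉ A, η * s ≤ ‖ξ j s - ξ a s‖) :
    |∑ j ∈ A, M j * (√(1 - ‖v j t₂‖ ^ 2))⁻¹ - ∑ j ∈ A, M j * (√(1 - ‖v j t₁‖ ^ 2))⁻¹| ≤
        |C| * (2 * ((η / 4) ^ (3 / 2 : ℝ))⁻¹ * (t₁ ^ (1 / 2 : ℝ))⁻¹) + ζ t₁ + ζ t₂ ∧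
      ‖∑ j ∈ A, (M j * (√(1 - ‖v j t₂‖ ^ 2))⁻¹) • v j t₂ - ∑ j ∈ A, (M j * (√(1 - ‖v j t₁‖ ^ 2))⁻¹) • v j t₁‖ ≤
        3 * (|C| * (2 * ((η / 4) ^ (3 / 2 : ℝ))⁻¹ * (t₁ ^ (1 / 2 : ℝ))⁻¹) + ζ t₁ + ζ t₂) ∧
      |(∑ j ∈ A, M j * (√(1 - ‖v j t₂‖ ^ 2))⁻¹ -
          √((∑ i ∈ A, M i) ^ 2 + ‖∑ j ∈ A, (M j * (√(1 - ‖v j t₂‖ ^ 2))⁻¹) • v j t₂‖ ^ 2)) -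
        (∑ j ∈ A, M j * (√(1 - ‖v j t₁‖ ^ 2))⁻¹ -
          √((∑ i ∈ A, M i) ^ 2 + ‖∑ j ∈ A, (M j * (√(1 - ‖v j t₁‖ ^ 2))⁻¹) • v j t₁‖ ^ 2))| ≤
        4 * (|C| * (2 * ((η / 4) ^ (3 / 2 : ℝ))⁻¹ * (t₁ ^ (1 / 2 : ℝ))⁻¹) + ζ t₁ + ζ t₂) := by
  classical
  have hη4 : 0 < η / 4 := by positivity
  have hinc := Oracle.increment_of_windowPath M ξ v κ P ρ C T T' T₀ ζ hWL hID hdiff hspeed (A := A) (a := a)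
    (t₁ := t₁) (t₂ := t₂) (R := fun s ↦ η / 4 * s) hT hT' hT₀ h12
    (fun s _ s' _ ↦ by
      show |η / 4 * s - η / 4 * s'| ≤ 2 * |s - s'|
      rw [← mul_sub, abs_mul, abs_of_pos hη4]
      exact mul_le_mul_of_nonneg_right (by linarith) (abs_nonneg _))
    (fun s hs ↦ mul_pos hη4 (ht₁.trans_le hs.1))
    (fun s hs ↦ by have := hρ s hs; show ρ s ≤ η / 4 * s / 2; linarith)
    hcap
    (fun s hs i hi ↦ by have := hmem s hs i hi; show ‖ξ i s - ξ a s‖ ≤ η / 4 * s / 2; linarith)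
    (fun s hs j hj ↦ by
      have h := hnon s hs j hj
      show 3 * (η / 4 * s) / 2 ≤ ‖ξ j s - ξ a s‖
      have := ht₁.trans_le hs.1
      nlinarith)
  -- the budget
  have hint : ∫ s in t₁..t₂, ((η / 4 * s) ^ (3 / 2 : ℝ))⁻¹ ≤ 2 * ((η / 4) ^ (3 / 2 : ℝ))⁻¹ * (t₁ ^ (1 / 2 : ℝ))⁻¹ :=
    Endgame.integral_inv_rpow_three_halves_mul_le hη4 ht₁ h12
  have hint0 : 0 ≤ ∫ s in t₁..t₂, ((η / 4 * s) ^ (3 / 2 : ℝ))⁻¹ :=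
    intervalIntegral.integral_nonneg h12 fun s hs ↦
      (inv_pos.mpr (Real.rpow_pos_of_pos (mul_pos hη4 (ht₁.trans_le hs.1)) _)).le
  set Bd : ℝ := |C| * (2 * ((η / 4) ^ (3 / 2 : ℝ))⁻¹ * (t₁ ^ (1 / 2 : ℝ))⁻¹) + ζ t₁ + ζ t₂ with hBd
  have hCle : C * (∫ s in t₁..t₂, ((η / 4 * s) ^ (3 / 2 : ℝ))⁻¹) + ζ t₁ + ζ t₂ ≤ Bd := by
    have h1 : C * (∫ s in t₁..t₂, ((η / 4 * s) ^ (3 / 2 : ℝ))⁻¹) ≤ |C| * ∫ s in t₁..t₂, ((η / 4 * s) ^ (3 / 2 : ℝ))⁻¹ :=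
      mul_le_mul_of_nonneg_right (le_abs_self C) hint0
    have h2 := mul_le_mul_of_nonneg_left hint (abs_nonneg C)
    rw [hBd]; linarith
  have hE : |∑ j ∈ A, M j * (√(1 - ‖v j t₂‖ ^ 2))⁻¹ - ∑ j ∈ A, M j * (√(1 - ‖v j t₁‖ ^ 2))⁻¹| ≤ Bd :=
    hinc.1.trans hCle
  have hPk : ∀ k : Fin 3, |∑ j ∈ A, M j * (√(1 - ‖v j t₂‖ ^ 2))⁻¹ * v j t₂ k -
      ∑ j ∈ A, M j * (√(1 - ‖v j t₁‖ ^ 2))⁻¹ * v j t₁ k| ≤ Bd := fun k ↦ (hinc.2 k).trans hCle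
  have hP : ‖∑ j ∈ A, (M j * (√(1 - ‖v j t₂‖ ^ 2))⁻¹) • v j t₂ - ∑ j ∈ A, (M j * (√(1 - ‖v j t₁‖ ^ 2))⁻¹) • v j t₁‖ ≤
      3 * Bd := Oracle.norm_momentum_sub_le_of_components A M (fun j ↦ v j t₁) (fun j ↦ v j t₂) hPk
  refine ⟨hE, hP, ?_⟩
  have hK := abs_internalEnergy_sub_le (∑ i ∈ A, M i) (∑ j ∈ A, M j * (√(1 - ‖v j t₂‖ ^ 2))⁻¹)
    (∑ j ∈ A, M j * (√(1 - ‖v j t₁‖ ^ 2))⁻¹) (∑ j ∈ A, (M j * (√(1 - ‖v j t₂‖ ^ 2))⁻¹) • v j t₂)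
    (∑ j ∈ A, (M j * (√(1 - ‖v j t₁‖ ^ 2))⁻¹) • v j t₁)
  linarith

/-- Registered one-line helper of this file: the budget bound `C∫ ≤ |C|·2c^{-3/2}t₁^{-1/2}` along a linear radius. [folklore] -/
theorem mul_integral_inv_rpow_le_abs : open MeasureTheory intervalIntegral in ∀ {C c t₁ t₂ : ℝ}, 0 < c → 0 < t₁ → t₁ ≤ t₂ → C * ∫ s in t₁..t₂, ((c * s) ^ (3 / 2 : ℝ))⁻¹ ≤ |C| * (2 * (c ^ (3 / 2 : ℝ))⁻¹ * (t₁ ^ (1 / 2 : ℝ))⁻¹) := by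
  intro C c t₁ t₂ hc ht₁ h12
  have hint := Endgame.integral_inv_rpow_three_halves_mul_le hc ht₁ h12
  have hint0 : 0 ≤ ∫ s in t₁..t₂, ((c * s) ^ (3 / 2 : ℝ))⁻¹ :=
    intervalIntegral.integral_nonneg h12 fun s hs ↦
      (inv_pos.mpr (Real.rpow_pos_of_pos (mul_pos hc (ht₁.trans_le hs.1)) _)).le
  calc C * ∫ s in t₁..t₂, ((c * s) ^ (3 / 2 : ℝ))⁻¹ ≤ |C| * ∫ s in t₁..t₂, ((c * s) ^ (3 / 2 : ℝ))⁻¹ :=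
        mul_le_mul_of_nonneg_right (le_abs_self C) hint0
    _ ≤ |C| * (2 * (c ^ (3 / 2 : ℝ))⁻¹ * (t₁ ^ (1 / 2 : ℝ))⁻¹) := mul_le_mul_of_nonneg_left hint (abs_nonneg C)

end Summit.FinalStateConjecture.FinalStateConjecture.Theorems.SublinearIsFree.Virial

end
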